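import Literature.InformationTheory.QuantumCodes.CSSFiniteSizeBounds
import Literature.InformationTheory.QuantumCodes.CSSPhenomenologicalAnisotropic
import HarnessLib

/-!
# One-code finite-size bounds with TWO phenomenological rates (`p ≠ q`) and with INHOMOGENEOUS code-capacity rates,
# in the `CSSCode` vocabulary and for every bivariate-bicycle code

Topic `Literature/InformationTheory/QuantumCodes` (venture QEC, LADDER-QEC Q5 × census; qec-type-09 gen 4, item 09.ANISO;
companion of `CSSFiniteSizeBounds.lean`, qec-lit-2: `CSSCode.zPhenomFailureProb_le_of_rowWeight` (`q = p`),
`BB.zPhenomFailureProb_le` (`3ℓmT (14s)^d/(7(1-14s))`, `s = √(p(1-p))`), …). Memory experiments have different data-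
and measurement-error rates; this file PROVES the same explicit bounds with `s := √(ρ(1-ρ))` for any `ρ ≥ p, q`
(qubit rate `p`, measurement rate `q`; via `CSSPhenom.phenomFailureProb_le_aniso_of_rowWeight`), and the code-capacity
bounds for qubit-dependent rates `p_v ≤ ρ` (via `sum_not_corrects_indep_le_of_rowWeight`). All PROVED, 0 facts:

* `CSSCode.zPhenomFailureProb_le_aniso_of_rowWeight` / `x…` — one CSS code, Z- and X-sector, `T` rounds, two rates;
* `CSSCode.zFailureProbInhom_le_of_rowWeight` / `x…` — one CSS code, code capacity, qubit-dependent rates;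
* **`BB.zPhenomFailureProb_le_aniso`** / `BB.x…` — every bivariate-bicycle code `QC(A, B)` (`IsBBPoly`): `T` rounds,
  `0 ≤ p, q ≤ ρ ≤ 1/2`, `14√(ρ(1-ρ)) < 1` ⇒ `P_fail(p,q) ≤ 3ℓmT · (14s)^d/(7(1-14s))`;
* **`BB.zFailureProbInhom_le`** / `BB.x…` — every BB code, qubit-dependent rates `≤ ρ`, `10√(ρ(1-ρ)) < 1` ⇒
  `P_fail ≤ 2ℓm · (10s)^d/(5(1-10s))`.

## References
* [DumerKovalevPryadko2015] I. Dumer, A. A. Kovalev, L. P. Pryadko, PRL 115 (2015) 050502, Thm 2 (y = 0), Thm 3, p. 5.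
* [BravyiEtAl2024] S. Bravyi et al., Nature 627 (2024) 778, §4 (checks of weight six).
-/

namespace Literature.InformationTheory.QuantumCodes

open Finset Matrix Filter Topology

/-! ### One CSS code -/

namespace CSSCode

variable {RX RZ Q : Type*} [Fintype Q] [DecidableEq Q]

/-- **Finite-size phenomenological bound with two rates** (`T` noisy rounds, one code, `Z`-sector; qubit rate `p`,
measurement rate `q`, `p, q ≤ ρ ≤ 1/2`): every minimum-weight space-time decoder has
`P_fail(p,q) ≤ (n + r_X) T · (2(w+1)s)^{d^Z} / ((w+1)(1 - 2(w+1)s))`, `s = √(ρ(1-ρ))`.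
[cite: DumerKovalevPryadko2015, Thm 3 with p. 5 (w → w + 2)] -/
theorem zPhenomFailureProb_le_aniso_of_rowWeight [Fintype RX] [DecidableEq RX] [Fintype RZ] (C : CSSCode RX RZ Q)
    (T : ℕ) {D : CSSPhenom.STDecoder RX Q T}
    (hD : D.IsMinWeight (CSSPhenom.stSyn C.HX T) (CSSPhenom.stCycles C.HX T) hammingNorm)
    {w : ℕ} (hrow : ∀ i, (rowSupp C.HX i).card ≤ w) (hd1 : 1 ≤ C.dZ)
    {p q ρ : ℝ} (hp0 : 0 ≤ p) (hq0 : 0 ≤ q) (hpρ : p ≤ ρ) (hqρ : q ≤ ρ) (hρ : ρ ≤ 1 / 2)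
    (hr : 2 * ((w + 1 : ℕ) : ℝ) * Real.sqrt (ρ * (1 - ρ)) < 1) :
    CSSPhenom.phenomFailureProb C.HX T (C.rowSpZ : Set (Q → ZMod 2)) D p q ≤
      (((Fintype.card Q + Fintype.card RX) * T : ℕ) : ℝ) *
          (2 * ((w + 1 : ℕ) : ℝ) * Real.sqrt (ρ * (1 - ρ))) ^ C.dZ /
        (((w + 1 : ℕ) : ℝ) * (1 - 2 * ((w + 1 : ℕ) : ℝ) * Real.sqrt (ρ * (1 - ρ)))) :=
  CSSPhenom.phenomFailureProb_le_aniso_of_rowWeight C.rowSpZ hD hrow hd1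
    (fun _ hx hxS => C.dZ_le_hammingNorm hx hxS) hp0 hq0 hpρ hqρ hρ hr

/-- **`X`-sector twin** (checks `H^Z`, trivial `rs H^X`, `d^X`). [cite: DumerKovalevPryadko2015, Thm 3 with p. 5 (w → w + 2)] -/
theorem xPhenomFailureProb_le_aniso_of_rowWeight [Fintype RX] [Fintype RZ] [DecidableEq RZ] (C : CSSCode RX RZ Q)
    (T : ℕ) {D : CSSPhenom.STDecoder RZ Q T}
    (hD : D.IsMinWeight (CSSPhenom.stSyn C.HZ T) (CSSPhenom.stCycles C.HZ T) hammingNorm)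
    {w : ℕ} (hrow : ∀ i, (rowSupp C.HZ i).card ≤ w) (hd1 : 1 ≤ C.dX)
    {p q ρ : ℝ} (hp0 : 0 ≤ p) (hq0 : 0 ≤ q) (hpρ : p ≤ ρ) (hqρ : q ≤ ρ) (hρ : ρ ≤ 1 / 2)
    (hr : 2 * ((w + 1 : ℕ) : ℝ) * Real.sqrt (ρ * (1 - ρ)) < 1) :
    CSSPhenom.phenomFailureProb C.HZ T (C.rowSpX : Set (Q → ZMod 2)) D p q ≤
      (((Fintype.card Q + Fintype.card RZ) * T : ℕ) : ℝ) *
          (2 * ((w + 1 : ℕ) : ℝ) * Real.sqrt (ρ * (1 - ρ))) ^ C.dX /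
        (((w + 1 : ℕ) : ℝ) * (1 - 2 * ((w + 1 : ℕ) : ℝ) * Real.sqrt (ρ * (1 - ρ)))) :=
  CSSPhenom.phenomFailureProb_le_aniso_of_rowWeight C.rowSpX hD hrow hd1
    (fun _ hx hxS => C.dX_le_hammingNorm hx hxS) hp0 hq0 hpρ hqρ hρ hr

open Classical in
/-- **`Z`-sector, code capacity with qubit-dependent rates** `0 ≤ r_v ≤ ρ ≤ 1/2`: checks `H^X` of weight `≤ w`
(`w ≥ 2`), every minimum-weight `Z`-decoder: `P_fail ≤ n r'^{d^Z}/((w-1)(1-r'))`, `r' = 2(w-1)√(ρ(1-ρ))`.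
[cite: DumerKovalevPryadko2015, Thm 2 (y = 0)] -/
theorem zFailureProbInhom_le_of_rowWeight [Fintype RX] [Fintype RZ] (C : CSSCode RX RZ Q)
    {D : Decoder (RX → ZMod 2) (Q → ZMod 2)}
    (hD : D.IsMinWeight C.zSyndrome (C.kerX : Set (Q → ZMod 2)) hammingNorm)
    {w : ℕ} (hw : 2 ≤ w) (hrow : ∀ i, (rowSupp C.HX i).card ≤ w) (hd1 : 1 ≤ C.dZ)
    {r : Q → ℝ} {ρ : ℝ} (hr0 : ∀ v, 0 ≤ r v) (hrρ : ∀ v, r v ≤ ρ) (hρ : ρ ≤ 1 / 2)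
    (hr : 2 * ((w - 1 : ℕ) : ℝ) * Real.sqrt (ρ * (1 - ρ)) < 1) :
    ∑ e ∈ univ.filter (fun e : Q → ZMod 2 => ¬ D.Corrects C.zSyndrome (C.rowSpZ : Set (Q → ZMod 2)) e),
        indepWeight r (supp e) ≤
      (Fintype.card Q : ℝ) * (2 * ((w - 1 : ℕ) : ℝ) * Real.sqrt (ρ * (1 - ρ))) ^ C.dZ /
        (((w - 1 : ℕ) : ℝ) * (1 - 2 * ((w - 1 : ℕ) : ℝ) * Real.sqrt (ρ * (1 - ρ)))) := by
  have hD' : D.IsMinWeight (fun e => C.HX *ᵥ e) {x | C.HX *ᵥ x = 0} hammingNorm := hD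
  exact sum_not_corrects_indep_le_of_rowWeight C.HX C.rowSpZ hD' hw hrow hd1
    (fun _ hx hxS => C.dZ_le_hammingNorm hx hxS) hr0 hrρ hρ hr

open Classical in
/-- **`X`-sector twin**, code capacity with qubit-dependent rates. [cite: DumerKovalevPryadko2015, Thm 2 (y = 0)] -/
theorem xFailureProbInhom_le_of_rowWeight [Fintype RX] [Fintype RZ] (C : CSSCode RX RZ Q)
    {D : Decoder (RZ → ZMod 2) (Q → ZMod 2)}
    (hD : D.IsMinWeight C.xSyndrome (C.kerZ : Set (Q → ZMod 2)) hammingNorm)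
    {w : ℕ} (hw : 2 ≤ w) (hrow : ∀ i, (rowSupp C.HZ i).card ≤ w) (hd1 : 1 ≤ C.dX)
    {r : Q → ℝ} {ρ : ℝ} (hr0 : ∀ v, 0 ≤ r v) (hrρ : ∀ v, r v ≤ ρ) (hρ : ρ ≤ 1 / 2)
    (hr : 2 * ((w - 1 : ℕ) : ℝ) * Real.sqrt (ρ * (1 - ρ)) < 1) :
    ∑ e ∈ univ.filter (fun e : Q → ZMod 2 => ¬ D.Corrects C.xSyndrome (C.rowSpX : Set (Q → ZMod 2)) e),
        indepWeight r (supp e) ≤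
      (Fintype.card Q : ℝ) * (2 * ((w - 1 : ℕ) : ℝ) * Real.sqrt (ρ * (1 - ρ))) ^ C.dX /
        (((w - 1 : ℕ) : ℝ) * (1 - 2 * ((w - 1 : ℕ) : ℝ) * Real.sqrt (ρ * (1 - ρ)))) := by
  have hD' : D.IsMinWeight (fun e => C.HZ *ᵥ e) {x | C.HZ *ᵥ x = 0} hammingNorm := hD
  exact sum_not_corrects_indep_le_of_rowWeight C.HZ C.rowSpX hD' hw hrow hd1
    (fun _ hx hxS => C.dX_le_hammingNorm hx hxS) hr0 hrρ hρ hr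

end CSSCode

/-! ### Every bivariate-bicycle code -/

namespace BB

variable {ℓ m : ℕ} [NeZero ℓ] [NeZero m]

/-- **Two-rate phenomenological bound for every bivariate-bicycle code** (`Z`-sector, `T` noisy rounds, qubit rate
`p`, measurement rate `q`, `0 ≤ p, q ≤ ρ ≤ 1/2`, EVERY minimum-weight space-time decoder, `14 s < 1` with
`s = √(ρ(1-ρ))`): `P_fail(p,q) ≤ 3ℓmT · (14 s)^d / (7 (1 - 14 s))`. [cite: DumerKovalevPryadko2015, Thm 3 with p. 5 (w → w + 2; here 6 → 8)] -/
theorem zPhenomFailureProb_le_aniso (C : Code ℓ m) (hA : IsBBPoly C.A) (hB : IsBBPoly C.B) (T : ℕ)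
    {D : CSSPhenom.STDecoder (Mono ℓ m) (Mono ℓ m ⊕ Mono ℓ m) T}
    (hD : D.IsMinWeight (CSSPhenom.stSyn C.HX T) (CSSPhenom.stCycles C.HX T) hammingNorm)
    (hd1 : 1 ≤ C.d) {p q ρ : ℝ} (hp0 : 0 ≤ p) (hq0 : 0 ≤ q) (hpρ : p ≤ ρ) (hqρ : q ≤ ρ) (hρ : ρ ≤ 1 / 2)
    (hr : 14 * Real.sqrt (ρ * (1 - ρ)) < 1) :
    CSSPhenom.phenomFailureProb C.HX T (C.css.rowSpZ : Set (Mono ℓ m ⊕ Mono ℓ m → ZMod 2)) D p q ≤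
      (3 * ℓ * m * T : ℕ) * (14 * Real.sqrt (ρ * (1 - ρ))) ^ C.d /
        (7 * (1 - 14 * Real.sqrt (ρ * (1 - ρ)))) := by
  have hd1' : 1 ≤ C.css.dZ := by rwa [← Code.d_eq_dZ]
  have hr' : 2 * ((6 + 1 : ℕ) : ℝ) * Real.sqrt (ρ * (1 - ρ)) < 1 := by norm_num; linarith
  have h := C.css.zPhenomFailureProb_le_aniso_of_rowWeight T hD (w := 6) (fun i => card_rowSupp_HX_le C hA hB i)
    hd1' hp0 hq0 hpρ hqρ hρ hr'
  rw [← Code.d_eq_dZ] at h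
  refine h.trans (le_of_eq ?_)
  have hcard : ((Fintype.card (Mono ℓ m ⊕ Mono ℓ m) + Fintype.card (Mono ℓ m)) * T : ℕ) = 3 * ℓ * m * T := by
    rw [card_qubits, card_checks]
    ring
  rw [hcard]
  have h7 : ((6 + 1 : ℕ) : ℝ) = 7 := by norm_num
  rw [h7]
  ring

/-- **`X`-sector twin** for every bivariate-bicycle code (`H^Z = [Bᵀ|Aᵀ]`, `d^X = d`).
[cite: DumerKovalevPryadko2015, Thm 3 with p. 5 (w → w + 2)] -/
theorem xPhenomFailureProb_le_aniso (C : Code ℓ m) (hA : IsBBPoly C.A) (hB : IsBBPoly C.B) (T : ℕ)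
    {D : CSSPhenom.STDecoder (Mono ℓ m) (Mono ℓ m ⊕ Mono ℓ m) T}
    (hD : D.IsMinWeight (CSSPhenom.stSyn C.HZ T) (CSSPhenom.stCycles C.HZ T) hammingNorm)
    (hd1 : 1 ≤ C.d) {p q ρ : ℝ} (hp0 : 0 ≤ p) (hq0 : 0 ≤ q) (hpρ : p ≤ ρ) (hqρ : q ≤ ρ) (hρ : ρ ≤ 1 / 2)
    (hr : 14 * Real.sqrt (ρ * (1 - ρ)) < 1) :
    CSSPhenom.phenomFailureProb C.HZ T (C.css.rowSpX : Set (Mono ℓ m ⊕ Mono ℓ m → ZMod 2)) D p q ≤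
      (3 * ℓ * m * T : ℕ) * (14 * Real.sqrt (ρ * (1 - ρ))) ^ C.d /
        (7 * (1 - 14 * Real.sqrt (ρ * (1 - ρ)))) := by
  have hd1' : 1 ≤ C.css.dX := by rwa [← Code.d_eq_dX]
  have hr' : 2 * ((6 + 1 : ℕ) : ℝ) * Real.sqrt (ρ * (1 - ρ)) < 1 := by norm_num; linarith
  have h := C.css.xPhenomFailureProb_le_aniso_of_rowWeight T hD (w := 6) (fun i => card_rowSupp_HZ_le C hA hB i)
    hd1' hp0 hq0 hpρ hqρ hρ hr'
  rw [← Code.d_eq_dX] at h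
  refine h.trans (le_of_eq ?_)
  have hcard : ((Fintype.card (Mono ℓ m ⊕ Mono ℓ m) + Fintype.card (Mono ℓ m)) * T : ℕ) = 3 * ℓ * m * T := by
    rw [card_qubits, card_checks]
    ring
  rw [hcard]
  have h7 : ((6 + 1 : ℕ) : ℝ) = 7 := by norm_num
  rw [h7]
  ring

open Classical in
/-- **Code capacity with qubit-dependent rates for every bivariate-bicycle code** (`Z`-sector, rates
`0 ≤ r_v ≤ ρ ≤ 1/2`, EVERY minimum-weight decoder, `10 s < 1`, `s = √(ρ(1-ρ))`):
`P_fail ≤ 2ℓm · (10 s)^d / (5 (1 - 10 s))`. [cite: DumerKovalevPryadko2015, Thm 2 (y = 0; w = 6)] -/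
theorem zFailureProbInhom_le (C : Code ℓ m) (hA : IsBBPoly C.A) (hB : IsBBPoly C.B)
    {D : Decoder (Mono ℓ m → ZMod 2) (Mono ℓ m ⊕ Mono ℓ m → ZMod 2)}
    (hD : D.IsMinWeight C.css.zSyndrome (C.css.kerX : Set (Mono ℓ m ⊕ Mono ℓ m → ZMod 2)) hammingNorm)
    (hd1 : 1 ≤ C.d) {r : Mono ℓ m ⊕ Mono ℓ m → ℝ} {ρ : ℝ} (hr0 : ∀ v, 0 ≤ r v) (hrρ : ∀ v, r v ≤ ρ)
    (hρ : ρ ≤ 1 / 2) (hs : 10 * Real.sqrt (ρ * (1 - ρ)) < 1) :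
    ∑ e ∈ univ.filter (fun e : Mono ℓ m ⊕ Mono ℓ m → ZMod 2 =>
        ¬ D.Corrects C.css.zSyndrome (C.css.rowSpZ : Set (Mono ℓ m ⊕ Mono ℓ m → ZMod 2)) e),
        indepWeight r (supp e) ≤
      (2 * ℓ * m : ℕ) * (10 * Real.sqrt (ρ * (1 - ρ))) ^ C.d / (5 * (1 - 10 * Real.sqrt (ρ * (1 - ρ)))) := by
  have hd1' : 1 ≤ C.css.dZ := by rwa [← Code.d_eq_dZ]
  have hr' : 2 * ((6 - 1 : ℕ) : ℝ) * Real.sqrt (ρ * (1 - ρ)) < 1 := by norm_num; linarith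
  have h := C.css.zFailureProbInhom_le_of_rowWeight hD (w := 6) (by norm_num)
    (fun i => card_rowSupp_HX_le C hA hB i) hd1' hr0 hrρ hρ hr'
  rw [card_qubits, ← Code.d_eq_dZ] at h
  refine h.trans (le_of_eq ?_)
  have h5 : ((6 - 1 : ℕ) : ℝ) = 5 := by norm_num
  rw [h5]
  norm_num

open Classical in
/-- **`X`-sector twin**, qubit-dependent rates, every bivariate-bicycle code.
[cite: DumerKovalevPryadko2015, Thm 2 (y = 0; w = 6)] -/
theorem xFailureProbInhom_le (C : Code ℓ m) (hA : IsBBPoly C.A) (hB : IsBBPoly C.B)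
    {D : Decoder (Mono ℓ m → ZMod 2) (Mono ℓ m ⊕ Mono ℓ m → ZMod 2)}
    (hD : D.IsMinWeight C.css.xSyndrome (C.css.kerZ : Set (Mono ℓ m ⊕ Mono ℓ m → ZMod 2)) hammingNorm)
    (hd1 : 1 ≤ C.d) {r : Mono ℓ m ⊕ Mono ℓ m → ℝ} {ρ : ℝ} (hr0 : ∀ v, 0 ≤ r v) (hrρ : ∀ v, r v ≤ ρ)
    (hρ : ρ ≤ 1 / 2) (hs : 10 * Real.sqrt (ρ * (1 - ρ)) < 1) :
    ∑ e ∈ univ.filter (fun e : Mono ℓ m ⊕ Mono ℓ m → ZMod 2 =>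
        ¬ D.Corrects C.css.xSyndrome (C.css.rowSpX : Set (Mono ℓ m ⊕ Mono ℓ m → ZMod 2)) e),
        indepWeight r (supp e) ≤
      (2 * ℓ * m : ℕ) * (10 * Real.sqrt (ρ * (1 - ρ))) ^ C.d / (5 * (1 - 10 * Real.sqrt (ρ * (1 - ρ)))) := by
  have hd1' : 1 ≤ C.css.dX := by rwa [← Code.d_eq_dX]
  have hr' : 2 * ((6 - 1 : ℕ) : ℝ) * Real.sqrt (ρ * (1 - ρ)) < 1 := by norm_num; linarith
  have h := C.css.xFailureProbInhom_le_of_rowWeight hD (w := 6) (by norm_num)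
    (fun i => card_rowSupp_HZ_le C hA hB i) hd1' hr0 hrρ hρ hr'
  rw [card_qubits, ← Code.d_eq_dX] at h
  refine h.trans (le_of_eq ?_)
  have h5 : ((6 - 1 : ℕ) : ℝ) = 5 := by norm_num
  rw [h5]
  norm_num

end BB

end Literature.InformationTheory.QuantumCodes
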